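import Literature.Combinatorics.Games.UniversalTrees

/-!
# Smallest universal trees are quasi-polynomial — proof of Theorem 3 of Czerwiński et al. 2019

This file discharges the named fact `OrderedTree.CzerwinskiEtAl2019_universal_lower` of
`Literature.Combinatorics.Games.UniversalTrees`: for all positive `ℓ, h`, every `(ℓ, h)`-universal
ordered tree has at least `C(⌊lg ℓ⌋ + h - 1, h - 1)` leaves
(W. Czerwiński, L. Daviaud, N. Fijalkow, M. Jurdziński, R. Lazić, P. Parys, *Universal trees grow
inside separating automata: quasi-polynomial lower bounds for parity games*, SODA 2019, Theorem 3,
first clause; arXiv:1807.10546 pp. 7–8).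

We follow the printed proof, specialised from the start to `ℓ = 2 ^ p` (the paper's
`G(p, h) = g(2^p, h)`; the general `ℓ` follows by monotonicity of universality since
`2 ^ ⌊lg ℓ⌋ ≤ ℓ`). The statement proved by induction on `h ≥ 1` is: every `(2^p, h)`-universal tree
has at least `C(p + h - 1, h - 1)` nodes at depth exactly `h` (and any tree has at least as many
leaves as nodes at a fixed depth). For the inductive step, given a `(2^p, h+1)`-universal `T` and
`k ≤ p`, the paper's tree `T_δ` (`δ = 2^k`) is the prefix-closed set of nodes of depth `≤ h` whose
depth-`h` members have at least `2^k` children; it is `(2^(p-k), h)`-universal because a tree `t`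
of height `≤ h` with `≤ 2^(p-k)` leaves, extended by `2^k` children below each depth-`h` node
(the paper's `t_+`), has `≤ 2^p` leaves and height `≤ h + 1`, so embeds into `T`, and the embedding
restricts to one of `t` into `T_δ`. Double counting the depth-`(h+1)` nodes by their parents and
Pascal's rule in the form `∑_{k ≤ p} C(k + h - 1, h - 1) = C(p + h, h)` finish the proof.

No new definitions: depth-`n` nodes are written `T.nodes.filter (·.length = n)` and the children
of a depth-`h` node `x` as the fibre of `List.dropLast` over `x` among the depth-`(h+1)` nodes.

## References

* [CDFJLP19] Czerwiński–Daviaud–Fijalkow–Jurdziński–Lazić–Parys, SODA 2019, Theorem 3 and its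
  proof (arXiv:1807.10546 pp. 7–8). [`CzerwinskiEtAl2019`]
-/

namespace Literature.Combinatorics.Games.OrderedTree

open Finset

/-! ## Generalities on ordered trees -/

/-- Every tree has at least as many leaves as nodes at any fixed depth `n`: each node extends to a
leaf (a maximal-length node above it), and distinct nodes of the same depth extend to distinct
leaves. [folklore] -/
theorem card_filter_length_le_card_leaves (T : OrderedTree) (n : ℕ) :
    (T.nodes.filter fun x => x.length = n).card ≤ T.leaves.card := by
  classical
  have key : ∀ x ∈ T.nodes, ∃ y ∈ T.leaves, x <+: y := by
    intro x hx
    obtain ⟨y, hy, hmax⟩ :=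
      Finset.exists_max_image (T.nodes.filter fun y => x <+: y) List.length ⟨x, by simp [hx]⟩
    simp only [Finset.mem_filter] at hy hmax
    refine ⟨y, mem_leaves.2 ⟨hy.1, fun z hz hyz => ?_⟩, hy.2⟩
    exact (hyz.eq_of_length_le (hmax z ⟨hz, hy.2.trans hyz⟩)).symm
  choose! g hg using key
  refine Finset.card_le_card_of_injOn g (fun x hx => (hg x (Finset.mem_filter.1 hx).1).1) ?_
  intro x hx x' hx' hxx'
  rw [Finset.coe_filter] at hx hx'
  have h1 : x <+: g x' := hxx' ▸ (hg x hx.1).2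
  have h2 : x' <+: g x' := (hg x' hx'.1).2
  exact (List.prefix_of_prefix_length_le h1 h2 (by rw [hx.2, hx'.2])).eq_of_length
    (by rw [hx.2, hx'.2])

/-- Isomorphic embeddings preserve the depth of nodes. [folklore] -/
theorem IsEmbedding.length_eq {t T : OrderedTree} {f : List ℕ → List ℕ} (hf : IsEmbedding t T f) :
    ∀ {x : List ℕ}, x ∈ t.nodes → (f x).length = x.length := by
  intro x
  induction x using List.reverseRecOn with
  | nil => intro; simp [hf.map_nil]
  | append_singleton x a ih =>
    intro hx
    obtain ⟨b, hb⟩ := hf.map_child hx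
    rw [hb, List.length_append, List.length_append,
      ih (t.mem_of_isPrefix hx (List.prefix_append _ _))]
    rfl

/-! ## The extension `t₊`: append `m` children below every depth-`h` node -/

/-- The paper's `t_+` (proof of Thm. 3): the nodes of `t` together with `m` new children
`x ++ [i]`, `i < m`, below every node `x` of depth `h`, form an ordered tree.
[cite: CzerwinskiEtAl2019, proof of Thm. 3] -/
theorem exists_extension (t : OrderedTree) (h m : ℕ) :
    ∃ t' : OrderedTree, t'.nodes = t.nodes ∪
      (t.nodes.filter fun x => x.length = h).biUnion fun x => (range m).image fun i => x ++ [i] := by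
  refine ⟨⟨_, mem_union_left _ t.nil_mem, ?_⟩, rfl⟩
  intro x y hy hxy
  rcases mem_union.1 hy with hy | hy
  · exact mem_union_left _ (t.mem_of_isPrefix hy hxy)
  · have hy' := hy
    simp only [mem_biUnion, mem_filter, mem_image, mem_range] at hy'
    obtain ⟨z, ⟨hz, -⟩, i, -, rfl⟩ := hy'
    rcases List.prefix_concat_iff.1 hxy with rfl | hxz
    · exact mem_union_right _ hy
    · exact mem_union_left _ (t.mem_of_isPrefix hz hxz)

/-- The new children `x ++ [i]` (`x` of depth `h`, `i < m`) are nodes of the extension. [folklore] -/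
theorem append_mem_extension {t t' : OrderedTree} {h m : ℕ}
    (ht' : t'.nodes = t.nodes ∪
      (t.nodes.filter fun x => x.length = h).biUnion fun x => (range m).image fun i => x ++ [i])
    {x : List ℕ} (hx : x ∈ t.nodes) (hxl : x.length = h) {i : ℕ} (hi : i < m) :
    x ++ [i] ∈ t'.nodes := by
  rw [ht', mem_union, mem_biUnion]
  exact Or.inr ⟨x, mem_filter.2 ⟨hx, hxl⟩, mem_image.2 ⟨i, mem_range.2 hi, rfl⟩⟩

/-- If `t` has height `≤ h`, its extension has height `≤ h + 1`. [folklore] -/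
theorem height_extension_le {t t' : OrderedTree} {h m : ℕ} (hth : t.height ≤ h)
    (ht' : t'.nodes = t.nodes ∪
      (t.nodes.filter fun x => x.length = h).biUnion fun x => (range m).image fun i => x ++ [i]) :
    t'.height ≤ h + 1 := by
  unfold height
  rw [ht']
  refine Finset.sup_le fun x hx => ?_
  rcases mem_union.1 hx with hx | hx
  · exact (length_le_height hx).trans (hth.trans (Nat.le_succ h))
  · simp only [mem_biUnion, mem_filter, mem_image, mem_range] at hx
    obtain ⟨z, ⟨-, hzl⟩, i, -, rfl⟩ := hx
    simp [hzl]

/-- If `t` has height `≤ h` and `1 ≤ m`, the extension has at most `m · #leaves(t)` leaves: its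
leaves are leaves of `t` not of depth `h`, or new children (`m` per depth-`h` node of `t`, and those
are leaves of `t`). This is the count "`t_+` has `⌊ℓ/δ⌋ · δ ≤ ℓ` leaves" of the paper.
[cite: CzerwinskiEtAl2019, proof of Thm. 3] -/
theorem card_leaves_extension_le {t t' : OrderedTree} {h m : ℕ} (hm : 1 ≤ m) (hth : t.height ≤ h)
    (ht' : t'.nodes = t.nodes ∪
      (t.nodes.filter fun x => x.length = h).biUnion fun x => (range m).image fun i => x ++ [i]) :
    t'.leaves.card ≤ m * t.leaves.card := by
  set D := t.nodes.filter fun x => x.length = h with hD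
  set N := D.biUnion fun x => (range m).image fun i => x ++ [i] with hN
  have hDl : D ⊆ t.leaves := by
    intro x hx
    rw [mem_filter] at hx
    refine mem_leaves.2 ⟨hx.1, fun y hy hxy => (hxy.eq_of_length_le ?_).symm⟩
    rw [hx.2]
    exact (length_le_height hy).trans hth
  have hsub : t'.leaves ⊆ (t.leaves \ D) ∪ N := by
    intro y hy
    rw [mem_leaves, ht'] at hy
    obtain ⟨hy1, hy2⟩ := hy
    rw [mem_union, mem_sdiff]
    rcases mem_union.1 hy1 with hy1 | hy1
    · refine Or.inl ⟨mem_leaves.2 ⟨hy1, fun z hz hyz => hy2 z (mem_union_left _ hz) hyz⟩,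
        fun hyD => ?_⟩
      have hmem : y ++ [0] ∈ t.nodes ∪ N :=
        mem_union_right _ (mem_biUnion.2 ⟨y, hyD, mem_image.2 ⟨0, mem_range.2 hm, rfl⟩⟩)
      have := congrArg List.length (hy2 _ hmem (List.prefix_append _ _))
      simp at this
    · exact Or.inr hy1
  have hDc : D.card ≤ t.leaves.card := card_le_card hDl
  obtain ⟨e, he⟩ : ∃ e, t.leaves.card = D.card + e := ⟨_, (Nat.add_sub_cancel' hDc).symm⟩
  calc t'.leaves.card ≤ ((t.leaves \ D) ∪ N).card := card_le_card hsub
    _ ≤ (t.leaves \ D).card + N.card := card_union_le _ _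
    _ ≤ (t.leaves.card - D.card) + D.card * m := by
        gcongr
        · exact (card_sdiff_of_subset hDl).le
        · calc N.card ≤ ∑ x ∈ D, ((range m).image fun i => x ++ [i]).card := card_biUnion_le
            _ ≤ ∑ x ∈ D, m := sum_le_sum fun x _ => card_image_le.trans (card_range m).le
            _ = D.card * m := by rw [sum_const, smul_eq_mul]
    _ ≤ m * t.leaves.card := by
        rw [he, Nat.add_sub_cancel_left]
        nlinarith

/-! ## The restriction `T_δ`: nodes of depth `≤ h` whose depth-`h` members have `≥ m` children -/

/-- The paper's `T_δ` (proof of Thm. 3), made prefix-closed: the nodes of `T` of depth at most `h`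
such that, if the depth is exactly `h`, the node has at least `m` children in `T`; together with the
root this is an ordered tree. [cite: CzerwinskiEtAl2019, proof of Thm. 3] -/
theorem exists_restriction (T : OrderedTree) (h m : ℕ) :
    ∃ T' : OrderedTree, T'.nodes = insert [] (T.nodes.filter fun x => x.length ≤ h ∧
      (x.length = h → m ≤ ((T.nodes.filter fun y => y.length = h + 1).filter
        fun y => y.dropLast = x).card)) := by
  refine ⟨⟨_, mem_insert_self _ _, ?_⟩, rfl⟩
  intro x y hy hxy
  rcases mem_insert.1 hy with rfl | hy
  · rw [List.prefix_nil.1 hxy]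
    exact mem_insert_self _ _
  · rw [mem_filter] at hy
    obtain ⟨hyT, hyl, hyP⟩ := hy
    refine mem_insert_of_mem (mem_filter.2 ⟨T.mem_of_isPrefix hyT hxy, hxy.length_le.trans hyl,
      fun hxl => ?_⟩)
    obtain rfl : x = y := hxy.eq_of_length_le (by omega)
    exact hyP hxl

/-- For `h ≥ 1`, the depth-`h` nodes of the restriction are exactly the depth-`h` nodes of `T` with
at least `m` children. [folklore] -/
theorem filter_length_restriction {T T' : OrderedTree} {h m : ℕ} (hh : 1 ≤ h)
    (hT' : T'.nodes = insert [] (T.nodes.filter fun x => x.length ≤ h ∧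
      (x.length = h → m ≤ ((T.nodes.filter fun y => y.length = h + 1).filter
        fun y => y.dropLast = x).card))) :
    (T'.nodes.filter fun x => x.length = h) = (T.nodes.filter fun x => x.length = h).filter
      fun x => m ≤ ((T.nodes.filter fun y => y.length = h + 1).filter
        fun y => y.dropLast = x).card := by
  ext x
  simp only [hT', mem_filter, mem_insert]
  constructor
  · rintro ⟨rfl | ⟨hx, -, hP⟩, hxl⟩
    · simp at hxl; omega
    · exact ⟨⟨hx, hxl⟩, hP hxl⟩
  · rintro ⟨⟨hx, hxl⟩, hP⟩
    exact ⟨Or.inr ⟨hx, hxl.le, fun _ => hP⟩, hxl⟩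

/-- **Key step** (Czerwiński et al. 2019, proof of Thm. 3: "`T_δ` is `(⌊ℓ/δ⌋, h-1)`-universal"):
if `T` is `(2^p, h+1)`-universal and `k ≤ p`, then its restriction to depth `≤ h` keeping at depth
`h` only the nodes with at least `2^k` children is `(2^(p-k), h)`-universal. Given `t`, the
extension `t₊` (with `2^k` new children per depth-`h` node) embeds into `T`, and the embedding
restricts. [cite: CzerwinskiEtAl2019, proof of Thm. 3] -/
theorem isUniversal_restriction {T T' : OrderedTree} {h p k : ℕ} (hk : k ≤ p)
    (hT : IsUniversal (2 ^ p) (h + 1) T)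
    (hT' : T'.nodes = insert [] (T.nodes.filter fun x => x.length ≤ h ∧
      (x.length = h → 2 ^ k ≤ ((T.nodes.filter fun y => y.length = h + 1).filter
        fun y => y.dropLast = x).card))) :
    IsUniversal (2 ^ (p - k)) h T' := by
  intro t hth htl
  obtain ⟨t', ht'⟩ := exists_extension t h (2 ^ k)
  have hsub : t.nodes ⊆ t'.nodes := by
    rw [ht']
    exact subset_union_left
  have hleaves : t'.leaves.card ≤ 2 ^ p :=
    (card_leaves_extension_le Nat.one_le_two_pow hth ht').trans (by
      calc 2 ^ k * t.leaves.card ≤ 2 ^ k * 2 ^ (p - k) := Nat.mul_le_mul_left _ htl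
        _ = 2 ^ p := by rw [← pow_add, Nat.add_sub_cancel' hk])
  obtain ⟨f, hf⟩ := hT t' (height_extension_le hth ht') hleaves
  refine ⟨f, hf.map_nil, ?_, fun x a hxa => hf.map_child (hsub hxa),
    fun x a a' hxa hxa' haa' => hf.strictMono (hsub hxa) (hsub hxa') haa'⟩
  intro x hx
  have hlen : (f x).length = x.length := hf.length_eq (hsub hx)
  have hxh : x.length ≤ h := (length_le_height hx).trans hth
  rw [hT']
  refine mem_insert_of_mem (mem_filter.2 ⟨hf.mapsTo (hsub hx), hlen ▸ hxh, fun hfx => ?_⟩)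
  have hxl : x.length = h := hlen ▸ hfx
  have hc : ∀ i < 2 ^ k, x ++ [i] ∈ t'.nodes := fun i hi => append_mem_extension ht' hx hxl hi
  calc 2 ^ k = (range (2 ^ k)).card := (card_range _).symm
    _ ≤ _ := card_le_card_of_injOn (fun i => f (x ++ [i])) ?_ ?_
  · intro i hi
    have hi' : i < 2 ^ k := mem_range.1 (mem_coe.1 hi)
    obtain ⟨b, hb⟩ := hf.map_child (hc i hi')
    rw [coe_filter, Set.mem_setOf_eq, mem_filter]
    refine ⟨⟨hf.mapsTo (hc i hi'), ?_⟩, ?_⟩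
    · show (f (x ++ [i])).length = h + 1
      rw [hb, List.length_append, hfx]
      rfl
    · show (f (x ++ [i])).dropLast = f x
      rw [hb, List.dropLast_concat]
  · intro i hi j hj hij
    have hi' : i < 2 ^ k := mem_range.1 (mem_coe.1 hi)
    have hj' : j < 2 ^ k := mem_range.1 (mem_coe.1 hj)
    simp only at hij
    rcases lt_trichotomy i j with hlt | rfl | hlt
    · exact absurd (hij ▸ hf.strictMono (hc i hi') (hc j hj') hlt) (Std.Irrefl.irrefl _)
    · rfl
    · exact absurd (hij ▸ hf.strictMono (hc j hj') (hc i hi') hlt) (Std.Irrefl.irrefl _)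

/-! ## Double counting and the induction -/

/-- Double counting (Czerwiński et al. 2019, proof of Thm. 3:
"`∑_i ℓ_i · i = ∑_δ ∑_{i ≥ δ} ℓ_i`"), restricted to `δ = 2^k`: summing over `k ≤ p` the number of
depth-`h` nodes with at least `2^k` children gives at most the number of depth-`(h+1)` nodes.
[cite: CzerwinskiEtAl2019, proof of Thm. 3] -/
theorem sum_card_filter_le (T : OrderedTree) (h p : ℕ) :
    ∑ k ∈ range (p + 1), ((T.nodes.filter fun x => x.length = h).filter
        fun x => 2 ^ k ≤ ((T.nodes.filter fun y => y.length = h + 1).filter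
          fun y => y.dropLast = x).card).card ≤
      (T.nodes.filter fun y => y.length = h + 1).card := by
  have hB : (T.nodes.filter fun y => y.length = h + 1).card =
      ∑ x ∈ T.nodes.filter (fun x => x.length = h),
        ((T.nodes.filter fun y => y.length = h + 1).filter fun y => y.dropLast = x).card := by
    refine card_eq_sum_card_fiberwise fun y hy => ?_
    rw [coe_filter, Set.mem_setOf_eq] at hy ⊢
    refine ⟨T.mem_of_isPrefix hy.1 (List.dropLast_prefix y), ?_⟩
    rw [List.length_dropLast, hy.2]
    rfl
  rw [hB]
  simp only [card_filter]
  rw [sum_comm]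
  refine sum_le_sum fun x _ => ?_
  rw [← card_filter, ← card_filter]
  calc ((range (p + 1)).filter fun k => 2 ^ k ≤ ((T.nodes.filter fun y => y.length = h + 1).filter
          fun y => y.dropLast = x).card).card
      ≤ (range (((T.nodes.filter fun y => y.length = h + 1).filter
          fun y => y.dropLast = x).card)).card := by
        refine card_le_card fun k hk => ?_
        rw [mem_filter] at hk
        exact mem_range.2 (lt_of_lt_of_le Nat.lt_two_pow_self hk.2)
    _ = _ := card_range _

/-- **The induction** (Czerwiński et al. 2019, proof of Thm. 3, with `G(p, h) = g(2^p, h)` and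
`G(p, h) ≥ ∑_{k ≤ p} G(p - k, h - 1)`, `Ḡ(p, h) = C(p + h - 1, p)`): for `h ≥ 1`, every
`(2^p, h)`-universal tree has at least `C(p + h - 1, h - 1)` nodes at depth `h`.
[cite: CzerwinskiEtAl2019, proof of Thm. 3] -/
theorem choose_le_card_filter_length {h : ℕ} (hh : 1 ≤ h) :
    ∀ (p : ℕ) (T : OrderedTree), IsUniversal (2 ^ p) h T →
      Nat.choose (p + h - 1) (h - 1) ≤ (T.nodes.filter fun x => x.length = h).card := by
  induction h, hh using Nat.le_induction with
  | base =>
    intro p T hT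
    obtain ⟨t', ht'⟩ := exists_extension root 0 1
    have hh' : t'.height ≤ 1 := height_extension_le (by rw [height_root]) ht'
    have hl' : t'.leaves.card ≤ 2 ^ p :=
      (card_leaves_extension_le le_rfl (by rw [height_root]) ht').trans
        (by rw [leaves_root, card_singleton]; exact Nat.one_le_two_pow)
    obtain ⟨f, hf⟩ := hT t' hh' hl'
    have h0 : [] ++ [0] ∈ t'.nodes := append_mem_extension ht' root.nil_mem rfl Nat.one_pos
    obtain ⟨b, hb⟩ := hf.map_child h0
    have hmem : f ([] ++ [0]) ∈ T.nodes.filter fun x => x.length = 1 :=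
      mem_filter.2 ⟨hf.mapsTo h0, by rw [hb, hf.map_nil]; rfl⟩
    simpa using card_pos.2 ⟨_, hmem⟩
  | succ h hh ih =>
    intro p T hT
    have e1 : p + (h + 1) - 1 = p + h := by omega
    have e2 : h + 1 - 1 = h := rfl
    rw [e1, e2]
    calc Nat.choose (p + h) h = ∑ k ∈ range (p + 1), Nat.choose (k + (h - 1)) (h - 1) := by
          rw [Nat.sum_range_add_choose]
          congr 1 <;> omega
      _ = ∑ k ∈ range (p + 1), Nat.choose (p - k + (h - 1)) (h - 1) := by
          rw [← sum_range_reflect]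
          refine sum_congr rfl fun k _ => ?_
          show Nat.choose (p + 1 - 1 - k + (h - 1)) (h - 1) = _
          rw [Nat.add_sub_cancel]
      _ ≤ ∑ k ∈ range (p + 1), ((T.nodes.filter fun x => x.length = h).filter
            fun x => 2 ^ k ≤ ((T.nodes.filter fun y => y.length = h + 1).filter
              fun y => y.dropLast = x).card).card := by
          refine sum_le_sum fun k hk => ?_
          have hkp : k ≤ p := Nat.lt_succ_iff.1 (mem_range.1 hk)
          obtain ⟨T', hT'⟩ := exists_restriction T h (2 ^ k)
          have := ih (p - k) T' (isUniversal_restriction hkp hT hT')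
          have e3 : p - k + h - 1 = p - k + (h - 1) := by omega
          rw [filter_length_restriction hh hT', e3] at this
          exact this
      _ ≤ _ := sum_card_filter_le T h p

/-- **Theorem 3 of Czerwiński et al. 2019, first clause** (discharge of the named fact
`CzerwinskiEtAl2019_universal_lower`): for all positive integers `ℓ` and `h`, every
`(ℓ, h)`-universal ordered tree has at least `C(⌊lg ℓ⌋ + h - 1, h - 1)` leaves. Proof: with
`p = ⌊lg ℓ⌋ = Nat.log 2 ℓ`, `T` is `(2^p, h)`-universal, so has at least `C(p + h - 1, h - 1)`
nodes at depth `h` (`choose_le_card_filter_length`), hence at least as many leaves.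
[cite: CzerwinskiEtAl2019, Thm. 3] -/
theorem CzerwinskiEtAl2019_universal_lower_holds : CzerwinskiEtAl2019_universal_lower := by
  intro ℓ h hℓ hh T hT
  have hp : 2 ^ Nat.log 2 ℓ ≤ ℓ := Nat.pow_log_le_self 2 hℓ.ne'
  exact (choose_le_card_filter_length hh (Nat.log 2 ℓ) T (hT.mono hp le_rfl)).trans
    (card_filter_length_le_card_leaves T h)

end Literature.Combinatorics.Games.OrderedTree
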